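import Literature.MathematicalPhysics.QuantumLattice.LiebWuChemicalPotentialFilling
import Literature.MathematicalPhysics.QuantumLattice.LiebWuChemicalPotentialKernel
import HarnessLib

/-!
# Lieb–Wu 2003, §7.1: the perturbation `δσ` of the rapidity density near half filling, paired with the
# `cos²`-moment test function (eq. (deltaf) `f ≈ f₀ + ûâf₀ - 2ûâ t`, and "(ûâ g)(x) ≈ 2a u(x) g(0)")

E. H. Lieb, F. Y. Wu, Physica A 321 (2003) 1, §7.1 (arXiv:cond-mat/0207529 p. 16): with `B = ∞`, `Q = π - a`,
`δf = f - f₀`,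

> We turn to (fiterate2) and find, to leading order, that `f ≈ (1 + 2û)t - ûât + 2ûâût = f₀ + ûâf₀ - 2ûât`
> … If `g` is continuous near `0` … then `(ûâ g)(x) = ∫_{-a}^{a} u(x - y) g(y) dy ≈ 2a u(x - 0) g(0)` to
> leading order in `a`.

In the tree's `B = ∞` machinery (`LiebWuNeumannSeries`: `σ_Q = ξ_Q + Ŵ_Q σ_Q`, window `(-sin Q, sin Q]`;
`G_Q = σ_Q ∗ K`) the decomposition reads `σ_Q - σ_π = (ξ_Q - ξ_π) + Ŵ_Q σ_Q` (`Ŵ_π = 0`); this file pairs its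
two pieces with the test function `V(t) = ∫_{-π}^{π} cos²k K_{U/4}(sin k - t) dk` of
`LiebWuChemicalPotentialKernel` (Fubini), in preparation for the momentum form of eq. (dint)
(`LiebWuChemicalPotentialResponse`):

* `liebWuW_pi` (`Ŵ_π = 0`), `liebWuSigmaAt_sub_pi` (`σ_Q - σ_π = (ξ_Q - ξ_π) + Ŵ_Q σ_Q`);
* `integral_liebWuW_mul_cosSqCauchy`: `∫ (Ŵ_Q σ_Q) V = ½ ∫_{(-a,a]} G_Q(y) R(y) dy`, `R(y) = ∫ r(t - y) V(t) dt`;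
* `integral_liebWuXi_mul_cosSqCauchy`: `∫ ξ_Q V = (4π)⁻¹ ∫_{-Q}^{Q} R(sin k) dk`;
* `integral_sechKernel_sub_mul_cosSqCauchy_nonneg_le`: `0 ≤ R ≤ 2/(U/4)`.

No named facts; all statements proved.

## References

* E. H. Lieb, F. Y. Wu, Physica A 321 (2003) 1–27 = arXiv:cond-mat/0207529, §5 eq. (W), §7.1 eq. (deltaf)
  [LiebWuPhysicaA2003].
-/

noncomputable section

open MeasureTheory Set Real Filter intervalIntegral
open Literature.Analysis.SpecialFunctions Literature.Analysis.FunctionSpaces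
open scoped Topology Interval

namespace Literature.MathematicalPhysics.QuantumLattice

variable {U Q : ℝ}

/-! ### `δσ = (ξ_Q - ξ_π) + Ŵ_Q σ_Q` -/

/-- At `Q = π` the window `(-sin Q, sin Q]` is empty: `Ŵ_π = 0`. [cite: LiebWuPhysicaA2003, §5, eq. (W)] -/
theorem liebWuW_pi (U : ℝ) (h : ℝ → ℝ) : liebWuW U π h = 0 := by
  funext x
  simp [liebWuW, Real.sin_pi]

/-- **The perturbation of `σ` (eq. (deltaf) in the `σ`-picture):** `σ_Q - σ_π = (ξ_Q - ξ_π) + Ŵ_Q σ_Q`.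
[cite: LiebWuPhysicaA2003, §7.1, eq. (deltaf)] -/
theorem liebWuSigmaAt_sub_pi (hU : 0 < U) (hQ : 0 < Q) (t : ℝ) :
    liebWuSigmaAt U Q t - liebWuSigmaAt U π t =
      (liebWuXi U Q t - liebWuXi U π t) + liebWuW U Q (liebWuSigmaAt U Q) t := by
  have h1 := liebWuSigmaAt_eq_xi_add_W hU hQ t
  have h2 := liebWuSigmaAt_eq_xi_add_W hU Real.pi_pos t
  rw [liebWuW_pi] at h2
  simp only [Pi.zero_apply, add_zero] at h2
  rw [h1, h2]
  ring

/-! ### Fubini for the two pieces, tested against `V` -/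

/-- **`∫ (Ŵ_Q σ_Q)(t) V(t) dt = ½ ∫_{(-a,a]} G_Q(y) (∫ r(t - y) V(t) dt) dy`**, `a = sin Q`.
[cite: LiebWuPhysicaA2003, §7.1, "(ûâ g)(x) ≈ 2a u(x) g(0)"] -/
theorem integral_liebWuW_mul_cosSqCauchy (hU : 0 < U) (hQ : 0 < Q) :
    ∫ t, liebWuW U Q (liebWuSigmaAt U Q) t *
        ∫ k in (-π)..π, Real.cos k ^ 2 * cauchyDensity (U / 4) (Real.sin k - t) =
      1 / 2 * ∫ y in Ioc (-Real.sin Q) (Real.sin Q), liebWuG U Q univ y *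
        ∫ t, sechKernel (U / 4) (t - y) * ∫ k in (-π)..π, Real.cos k ^ 2 * cauchyDensity (U / 4) (Real.sin k - t) := by
  have hc : 0 < U / 4 := by positivity
  set S : Set ℝ := Ioc (-Real.sin Q) (Real.sin Q) with hS_def
  have hS : MeasurableSet S := measurableSet_Ioc
  set V : ℝ → ℝ := fun t => ∫ k in (-π)..π, Real.cos k ^ 2 * cauchyDensity (U / 4) (Real.sin k - t) with hV
  set G : ℝ → ℝ := liebWuG U Q univ with hG_def
  set r : ℝ → ℝ := sechKernel (U / 4) with hr_def
  have hVc : Continuous V := continuous_cosSqCauchy hU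
  have hVb : ∀ t, |V t| ≤ 2 / (U / 4) := fun t => by
    rw [abs_of_nonneg (cosSqCauchy_nonneg_le hU t).1]; exact (cosSqCauchy_nonneg_le hU t).2
  obtain ⟨hGc, hG0, hGi, hGle⟩ := liebWuG_props hU hQ MeasurableSet.univ
  have hrc : Continuous r := continuous_sechKernel hc
  have hri : Integrable r := integrable_sechKernel hc
  show ∫ t, liebWuW U Q (liebWuSigmaAt U Q) t * V t = 1 / 2 * ∫ y in S, G y * ∫ t, r (t - y) * V t
  -- `Ŵσ (t) = ½ ∫ 1_S(y) G(y) r(t - y) dy`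
  have hW : ∀ t, liebWuW U Q (liebWuSigmaAt U Q) t = 1 / 2 * ∫ y, S.indicator G y * r (t - y) := by
    intro t
    rw [liebWuW]
    congr 1
    refine integral_congr_ae (Eventually.of_forall fun y => ?_)
    show ((Ioc (-Real.sin Q) (Real.sin Q)).indicator (fun _ => (1 : ℝ)) y *
        ∫ t, liebWuSigmaAt U Q t * cauchyDensity (U / 4) (y - t)) * sechKernel (U / 4) (t - y) =
      S.indicator G y * r (t - y)
    by_cases hy : y ∈ S
    · rw [← hS_def, indicator_of_mem hy, indicator_of_mem hy, hG_def, liebWuG_univ, hr_def]; ring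
    · rw [← hS_def, indicator_of_notMem hy, indicator_of_notMem hy]; ring
  simp_rw [hW]
  -- the joint integrand `F t y = 1_S G(y) r(t - y) V(t)` is integrable
  have hSGi : Integrable (S.indicator G) := hGi.indicator hS
  have hSGb : ∀ y, |S.indicator G y| ≤ 1 / (π * (U / 4)) * ∫ t, liebWuSigmaAtS U Q univ t := by
    intro y
    by_cases hy : y ∈ S
    · rw [indicator_of_mem hy, abs_of_nonneg (hG0 y)]; exact hGle y
    · rw [indicator_of_notMem hy, abs_zero]
      exact mul_nonneg (by positivity) (integral_nonneg fun t => (liebWuSigmaAtS_pos hU hQ MeasurableSet.univ t).le)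
  have hFi : Integrable (Function.uncurry fun t y => S.indicator G y * r (t - y) * V t) (volume.prod volume) := by
    have hmaj := (hSGi.abs.mul_const (2 / (U / 4))).convolution_integrand (ContinuousLinearMap.mul ℝ ℝ) hri
    refine hmaj.mono' ?_ (Eventually.of_forall fun p => ?_)
    · have hm1 : Measurable fun p : ℝ × ℝ => S.indicator G p.2 :=
        (hGc.measurable.indicator hS).comp measurable_snd
      have hm2 : Measurable fun p : ℝ × ℝ => r (p.1 - p.2) := hrc.measurable.comp (measurable_fst.sub measurable_snd)
      have hm3 : Measurable fun p : ℝ × ℝ => V p.1 := hVc.measurable.comp measurable_fst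
      exact ((hm1.mul hm2).mul hm3).aestronglyMeasurable
    · rcases p with ⟨t, y⟩
      simp only [Function.uncurry_apply_pair, ContinuousLinearMap.mul_apply', Real.norm_eq_abs]
      rw [abs_mul, abs_mul, abs_of_pos (sechKernel_pos hc _)]
      have := hVb t
      have h0 : 0 ≤ |S.indicator G y| * r (t - y) := mul_nonneg (abs_nonneg _) (sechKernel_pos hc _).le
      calc |S.indicator G y| * r (t - y) * |V t| ≤ |S.indicator G y| * r (t - y) * (2 / (U / 4)) := by gcongr
        _ = |S.indicator G y| * (2 / (U / 4)) * r (t - y) := by ring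
  -- rewrite both sides as iterated integrals and swap
  have hL : ∀ t, (1 / 2 * ∫ y, S.indicator G y * r (t - y)) * V t =
      1 / 2 * ∫ y, S.indicator G y * r (t - y) * V t := by
    intro t
    rw [mul_assoc, ← MeasureTheory.integral_mul_const]
  simp_rw [hL]
  rw [MeasureTheory.integral_const_mul, MeasureTheory.integral_integral_swap hFi]
  congr 1
  rw [← MeasureTheory.integral_indicator hS]
  refine integral_congr_ae (Eventually.of_forall fun y => ?_)
  beta_reduce
  by_cases hy : y ∈ S
  · rw [indicator_of_mem hy, indicator_of_mem hy, ← MeasureTheory.integral_const_mul]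
    refine integral_congr_ae (Eventually.of_forall fun t => ?_)
    ring
  · simp [indicator_of_notMem hy]

/-- **`∫ ξ_Q(t) V(t) dt = (4π)⁻¹ ∫_{-Q}^{Q} (∫ r(t - sin k) V(t) dt) dk`.** [cite: LiebWuPhysicaA2003, §5, eq. (S)] -/
theorem integral_liebWuXi_mul_cosSqCauchy (hU : 0 < U) (Q : ℝ) :
    ∫ t, liebWuXi U Q t * ∫ k in (-π)..π, Real.cos k ^ 2 * cauchyDensity (U / 4) (Real.sin k - t) =
      1 / (4 * π) * ∫ k in -Q..Q,
        ∫ t, sechKernel (U / 4) (t - Real.sin k) * ∫ k' in (-π)..π, Real.cos k' ^ 2 * cauchyDensity (U / 4) (Real.sin k' - t) := by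
  have hc : 0 < U / 4 := by positivity
  set V : ℝ → ℝ := fun t => ∫ k in (-π)..π, Real.cos k ^ 2 * cauchyDensity (U / 4) (Real.sin k - t) with hV
  set r : ℝ → ℝ := sechKernel (U / 4) with hr_def
  have hVc : Continuous V := continuous_cosSqCauchy hU
  have hVb : ∀ t, |V t| ≤ 2 / (U / 4) := fun t => by
    rw [abs_of_nonneg (cosSqCauchy_nonneg_le hU t).1]; exact (cosSqCauchy_nonneg_le hU t).2
  have hrc : Continuous r := continuous_sechKernel hc
  have hri : Integrable r := integrable_sechKernel hc
  show ∫ t, liebWuXi U Q t * V t = 1 / (4 * π) * ∫ k in -Q..Q, ∫ t, r (t - Real.sin k) * V t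
  -- integrability on `Ι(-Q,Q) × ℝ`
  have hFi : Integrable (Function.uncurry fun k t => r (t - Real.sin k) * V t)
      ((volume.restrict (Ι (-Q) Q)).prod volume) := by
    haveI : IsFiniteMeasure (volume.restrict (Ι (-Q) Q)) := by
      refine isFiniteMeasure_restrict.2 ?_
      simp [Set.uIoc, Real.volume_Ioc]
    have hmeas : AEStronglyMeasurable (Function.uncurry fun k t => r (t - Real.sin k) * V t)
        ((volume.restrict (Ι (-Q) Q)).prod volume) :=
      (by fun_prop : Continuous (Function.uncurry fun k t => r (t - Real.sin k) * V t)).aestronglyMeasurable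
    rw [integrable_prod_iff hmeas]
    refine ⟨Eventually.of_forall fun k => ?_, ?_⟩
    · exact (hri.comp_sub_right (Real.sin k)).mul_bdd hVc.aestronglyMeasurable
        (Eventually.of_forall fun t => by rw [Real.norm_eq_abs]; exact hVb t)
    · have hbound : ∀ k, ∫ t, ‖r (t - Real.sin k) * V t‖ ≤ 2 / (U / 4) := by
        intro k
        calc ∫ t, ‖r (t - Real.sin k) * V t‖ ≤ ∫ t, r (t - Real.sin k) * (2 / (U / 4)) := by
              refine integral_mono_of_nonneg (Eventually.of_forall fun t => norm_nonneg _)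
                ((hri.comp_sub_right (Real.sin k)).mul_const _) (Eventually.of_forall fun t => ?_)
              beta_reduce
              rw [Real.norm_eq_abs, abs_mul, abs_of_pos (sechKernel_pos hc _)]
              exact mul_le_mul_of_nonneg_left (hVb t) (sechKernel_pos hc _).le
          _ = 2 / (U / 4) := by
              rw [MeasureTheory.integral_mul_const, integral_sub_right_eq_self r (Real.sin k), integral_sechKernel hc, one_mul]
      have hnn : ∀ k, 0 ≤ ∫ t, ‖r (t - Real.sin k) * V t‖ := fun k => integral_nonneg fun t => norm_nonneg _
      refine Integrable.mono' (integrable_const (2 / (U / 4))) hmeas.norm.integral_prod_right'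
        (Eventually.of_forall fun k => ?_)
      change ‖∫ t, ‖r (t - Real.sin k) * V t‖‖ ≤ _
      rw [Real.norm_eq_abs, abs_of_nonneg (hnn k)]; exact hbound k
  -- left side as an iterated integral
  have hL : ∀ t, liebWuXi U Q t * V t = 1 / (4 * π) * ∫ k in -Q..Q, r (t - Real.sin k) * V t := by
    intro t
    rw [liebWuXi, mul_assoc, ← intervalIntegral.integral_mul_const]
  simp_rw [hL]
  rw [MeasureTheory.integral_const_mul, ← MeasureTheory.intervalIntegral_integral_swap hFi]

/-! ### Bounds for `R(y) = ∫ r(t - y) V(t) dt` -/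

/-- `0 ≤ R(y) ≤ 2/c`. [cite: LiebWuPhysicaA2003, §7.1, eq. (dint)] -/
theorem integral_sechKernel_sub_mul_cosSqCauchy_nonneg_le (hU : 0 < U) (y : ℝ) :
    0 ≤ ∫ t, sechKernel (U / 4) (t - y) * ∫ k in (-π)..π, Real.cos k ^ 2 * cauchyDensity (U / 4) (Real.sin k - t) ∧
      ∫ t, sechKernel (U / 4) (t - y) * ∫ k in (-π)..π, Real.cos k ^ 2 * cauchyDensity (U / 4) (Real.sin k - t)
        ≤ 2 / (U / 4) := by
  have hc : 0 < U / 4 := by positivity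
  have hri := (integrable_sechKernel hc).comp_sub_right y
  have hV := cosSqCauchy_nonneg_le hU
  refine ⟨integral_nonneg fun t => mul_nonneg (sechKernel_pos hc _).le (hV t).1, ?_⟩
  calc ∫ t, sechKernel (U / 4) (t - y) * ∫ k in (-π)..π, Real.cos k ^ 2 * cauchyDensity (U / 4) (Real.sin k - t)
      ≤ ∫ t, sechKernel (U / 4) (t - y) * (2 / (U / 4)) :=
        integral_mono_of_nonneg (Eventually.of_forall fun t => mul_nonneg (sechKernel_pos hc _).le (hV t).1)
          (hri.mul_const _) (Eventually.of_forall fun t => mul_le_mul_of_nonneg_left (hV t).2 (sechKernel_pos hc _).le)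
    _ = 2 / (U / 4) := by
        rw [MeasureTheory.integral_mul_const, integral_sub_right_eq_self (sechKernel (U / 4)) y,
          integral_sechKernel hc, one_mul]

end Literature.MathematicalPhysics.QuantumLattice
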